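import Mathlib
import Literature.Algebra.EuclideanLattices.QaryLatticeDuality
import Literature.Algebra.EuclideanLattices.KhotRandomSublattice
import HarnessLib

/-!
# Route LatticeMagic — crux `MagicFunctionsPersist` (stmt-PneNP-2328), line `Sketch`:
stub `stub_firstMoment` (Rogers–Loeliger first moment over `q`-ary lattices)

For a prime `q` and the uniform family of matrices `A ∈ (ℤ/q)^{k × n}` (here: all functions
`Fin k → Fin n → ZMod q`), a fixed integer vector `x ≢ 0 (mod q)` lies in
`Λ_q^⊥(A) = {x : A x ≡ 0}` for exactly `q^{kn}/q^k` matrices (each of the `k` rows lies in the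
hyperplane `x^⊥`, of size `q^{n-1}`), and a fixed `y ≢ 0 (mod q)` lies in `Λ_q(Aᵀ) = {y ≡ Aᵀ s}` for
at most `q^k · q^{kn}/q^n` of them (for each `s ≠ 0` the affine condition `Aᵀ s ≡ y` fixes each of
the `n` columns in a hyperplane translate of size `q^{k-1}`). Hence the UNION BOUND: if
`#X / q^k + #Y · q^k / q^n < 1` for finite sets `X, Y` of integer vectors that are nonzero mod `q`,
some `A` has `Λ_q^⊥(A) ∩ X = ∅` and `Λ_q(Aᵀ) ∩ Y = ∅`. This is the averaging argument of
Rogers (1947) / Loeliger (1997, averaging bounds for lattices from codes) in exact counting form;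
the hyperplane counts are the tree's `Khot.card_dotForm_eq_mul_of_one` (KhotRandomSublattice.lean).

The lattices are the tree's `perpLattice A`, `rowLattice A` (GadgetTrapdoor.lean).
-/

set_option linter.dupNamespace false -- `Summit.PneNP.PneNP.…`: summit = sub-problem (D-0017)

namespace Summit.PneNP.PneNP.Theorems.LatticeMagicMagicFunctionsPersist

open Matrix Finset Literature.Algebra.EuclideanLattices

section Counting

variable {q : ℕ} [Fact q.Prime] {m : ℕ}

/-- Over the field `ℤ/q`, the hyperplane `{a : a ⬝ x = 0}` of a nonzero vector `x ∈ (ℤ/q)^m` has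
exactly `q^m / q` elements: `#{a | a ⬝ᵥ x = 0} · q = q^m` (normalise a nonzero coordinate of `x`
to `1` and apply `Khot.card_dotForm_eq_mul_of_one`). -/
theorem card_dotProduct_eq_zero_mul {x : Fin m → ZMod q} (hx : x ≠ 0) :
    #{a : Fin m → ZMod q | a ⬝ᵥ x = 0} * q = q ^ m := by
  classical
  obtain ⟨i₀, hi₀⟩ : ∃ i, x i ≠ 0 := by
    by_contra h
    push Not at h
    exact hx (funext h)
  set c : ZMod q := (x i₀)⁻¹ with hc
  have hc0 : c ≠ 0 := inv_ne_zero hi₀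
  have hx' : (c • x) i₀ = 1 := by
    rw [Pi.smul_apply, smul_eq_mul, hc, inv_mul_cancel₀ hi₀]
  have hset : (univ.filter fun a : Fin m → ZMod q => a ⬝ᵥ x = 0) =
      univ.filter fun a : Fin m → ZMod q => a ⬝ᵥ (c • x) = 0 := by
    refine Finset.filter_congr fun a _ => ?_
    rw [dotProduct_smul, smul_eq_mul, mul_eq_zero, or_iff_right hc0]
  rw [hset]
  simpa using Khot.card_dotForm_eq_mul_of_one (c • x) hx' 0

/-- Over the field `ℤ/q`, an affine hyperplane `{a : a ⬝ s = y}` of a nonzero `s ∈ (ℤ/q)^m` has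
exactly `q^m / q` elements: `#{a | a ⬝ᵥ s = y} · q = q^m`. -/
theorem card_dotProduct_eq_mul {s : Fin m → ZMod q} (hs : s ≠ 0) (y : ZMod q) :
    #{a : Fin m → ZMod q | a ⬝ᵥ s = y} * q = q ^ m := by
  classical
  obtain ⟨i₀, hi₀⟩ : ∃ i, s i ≠ 0 := by
    by_contra h
    push Not at h
    exact hs (funext h)
  set c : ZMod q := (s i₀)⁻¹ with hc
  have hc0 : c ≠ 0 := inv_ne_zero hi₀
  have hs' : (c • s) i₀ = 1 := by
    rw [Pi.smul_apply, smul_eq_mul, hc, inv_mul_cancel₀ hi₀]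
  have hset : (univ.filter fun a : Fin m → ZMod q => a ⬝ᵥ s = y) =
      univ.filter fun a : Fin m → ZMod q => a ⬝ᵥ (c • s) = c * y := by
    refine Finset.filter_congr fun a _ => ?_
    rw [dotProduct_smul, smul_eq_mul]
    constructor
    · intro h; rw [h]
    · intro h; exact mul_left_cancel₀ hc0 h
  rw [hset]
  simpa using Khot.card_dotForm_eq_mul_of_one (c • s) hs' (c * y)

variable {k n : ℕ}

/-- **Matrices annihilating a fixed nonzero vector.** For `x ≠ 0` in `(ℤ/q)^n`, the number of
`F : Fin k → Fin n → ZMod q` with `F i ⬝ x = 0` for every row `i` is `q^{kn}/q^k`: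
`#{F | ∀ i, F i ⬝ᵥ x = 0} · q^k = q^{n k}`. -/
theorem card_rows_orthogonal_mul {x : Fin n → ZMod q} (hx : x ≠ 0) :
    #{F : Fin k → Fin n → ZMod q | ∀ i, F i ⬝ᵥ x = 0} * q ^ k = q ^ (n * k) := by
  classical
  have hset : (univ.filter fun F : Fin k → Fin n → ZMod q => ∀ i, F i ⬝ᵥ x = 0) =
      Fintype.piFinset fun _ : Fin k => univ.filter fun a : Fin n → ZMod q => a ⬝ᵥ x = 0 := by
    ext F
    simp [Fintype.mem_piFinset]
  rw [hset, Fintype.card_piFinset, prod_const, card_univ, Fintype.card_fin, ← mul_pow,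
    card_dotProduct_eq_zero_mul hx, ← pow_mul]

/-- **Matrices with `Fᵀ s = y` for a fixed nonzero `s`.** For `s ≠ 0` in `(ℤ/q)^k` and any
`y ∈ (ℤ/q)^n`, the number of `F : Fin k → Fin n → ZMod q` with `∑ᵢ sᵢ Fᵢⱼ = yⱼ` for every column
`j` is `q^{kn}/q^n`: `#{F | ∀ j, (fun i => F i j) ⬝ᵥ s = y j} · q^n = q^{k n}` (transpose and count
column by column). -/
theorem card_cols_affine_mul {s : Fin k → ZMod q} (hs : s ≠ 0) (y : Fin n → ZMod q) :
    #{F : Fin k → Fin n → ZMod q | ∀ j, (fun i => F i j) ⬝ᵥ s = y j} * q ^ n = q ^ (k * n) := by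
  classical
  -- transpose: `F ↦ (j ↦ i ↦ F i j)`
  let τ : (Fin k → Fin n → ZMod q) ≃ (Fin n → Fin k → ZMod q) :=
    { toFun := fun F j i => F i j
      invFun := fun G i j => G j i
      left_inv := fun _ => rfl
      right_inv := fun _ => rfl }
  have hmap : (univ.filter fun F : Fin k → Fin n → ZMod q => ∀ j, (fun i => F i j) ⬝ᵥ s = y j).map
      τ.toEmbedding =
      Fintype.piFinset fun j : Fin n => univ.filter fun g : Fin k → ZMod q => g ⬝ᵥ s = y j := by
    ext G
    simp only [mem_map_equiv, mem_filter, mem_univ, true_and, Fintype.mem_piFinset]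
    exact Iff.rfl
  rw [← Finset.card_map τ.toEmbedding, hmap, Fintype.card_piFinset]
  calc (∏ j, #(univ.filter fun g : Fin k → ZMod q => g ⬝ᵥ s = y j)) * q ^ n
      = ∏ j : Fin n, (#(univ.filter fun g : Fin k → ZMod q => g ⬝ᵥ s = y j) * q) := by
        rw [prod_mul_distrib, prod_const, card_univ, Fintype.card_fin]
    _ = ∏ _j : Fin n, q ^ k := prod_congr rfl fun j _ => card_dotProduct_eq_mul hs (y j)
    _ = q ^ (k * n) := by rw [prod_const, card_univ, Fintype.card_fin, pow_mul]

end Counting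

/-- **First moment over `A ∈ (ℤ/q)^{k×n}` (`q` prime)** — stub `stub_firstMoment` of line
`Sketch` for the crux `MagicFunctionsPersist` (stmt-PneNP-2328). A fixed integer vector
`x ≢ 0 (mod q)` lies in `Λ_q^⊥(A)` (`perpLattice A`) for exactly `q^{kn}/q^k` matrices `A`, and a
fixed `y ≢ 0 (mod q)` lies in `Λ_q(Aᵀ)` (`rowLattice A`) for at most `q^k · q^{kn}/q^n` of the
`q^{kn}` matrices; so if `#X / q^k + #Y · q^k / q^n < 1`, some `A` has `Λ_q^⊥(A) ∩ X = ∅` and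
`Λ_q(Aᵀ) ∩ Y = ∅` (union bound; Rogers 1947 / Loeliger 1997 averaging over linear codes, in
exact counting form). -/
theorem stub_firstMoment {q : ℕ} [Fact q.Prime] {k n : ℕ} (_hk : 0 < k) (_hn : 0 < n)
    (X Y : Finset (Fin n → ℤ)) (hX : ∀ x ∈ X, modQ q x ≠ 0) (hY : ∀ y ∈ Y, modQ q y ≠ 0)
    (hcard : (X.card : ℝ) / (q : ℝ) ^ k + (Y.card : ℝ) * (q : ℝ) ^ k / (q : ℝ) ^ n < 1) :
    ∃ A : Matrix (Fin k) (Fin n) (ZMod q),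
      (∀ x ∈ X, x ∉ perpLattice A) ∧ (∀ y ∈ Y, y ∉ rowLattice A) := by
  classical
  have hq : 0 < q := (Fact.out : q.Prime).pos
  have hqR : (0 : ℝ) < q := by exact_mod_cast hq
  -- the bad events, as finsets of `F : Fin k → Fin n → ZMod q`
  let badX : (Fin n → ℤ) → Finset (Fin k → Fin n → ZMod q) := fun x =>
    univ.filter fun F => ∀ i, F i ⬝ᵥ modQ q x = 0
  let badYs : (Fin n → ℤ) → (Fin k → ZMod q) → Finset (Fin k → Fin n → ZMod q) := fun y s =>
    univ.filter fun F => ∀ j, (fun i => F i j) ⬝ᵥ s = modQ q y j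
  let bad : Finset (Fin k → Fin n → ZMod q) :=
    X.biUnion badX ∪ Y.biUnion fun y => univ.biUnion (badYs y)
  -- sizes of the bad events (in `ℕ`, denominators multiplied out)
  have hbadX : ∀ x ∈ X, (badX x).card * q ^ k = q ^ (n * k) := fun x hx =>
    card_rows_orthogonal_mul (hX x hx)
  have hbadYs : ∀ y ∈ Y, ∀ s : Fin k → ZMod q, (badYs y s).card * q ^ n ≤ q ^ (k * n) := by
    intro y hy s
    by_cases hs : s = 0
    · -- `s = 0` forces `y ≡ 0`, which is excluded
      have hempty : badYs y s = ∅ := by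
        refine filter_eq_empty_iff.2 fun F _ hF => hY y hy (funext fun j => ?_)
        have := hF j
        rw [hs, dotProduct_zero] at this
        exact this.symm
      rw [hempty, card_empty, zero_mul]
      exact Nat.zero_le _
    · exact (card_cols_affine_mul hs (modQ q y)).le
  have hbadY : ∀ y ∈ Y, (univ.biUnion (badYs y)).card * q ^ n ≤ q ^ k * q ^ (k * n) := by
    intro y hy
    calc (univ.biUnion (badYs y)).card * q ^ n
        ≤ (∑ s, (badYs y s).card) * q ^ n := Nat.mul_le_mul_right _ card_biUnion_le
      _ = ∑ s : Fin k → ZMod q, (badYs y s).card * q ^ n := sum_mul ..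
      _ ≤ ∑ _s : Fin k → ZMod q, q ^ (k * n) := sum_le_sum fun s _ => hbadYs y hy s
      _ = q ^ k * q ^ (k * n) := by
          rw [sum_const, card_univ, smul_eq_mul, Fintype.card_pi_const, ZMod.card]
  -- the union bound, in `ℝ`
  have hXR : ((X.biUnion badX).card : ℝ) * (q : ℝ) ^ k ≤ X.card * (q : ℝ) ^ (n * k) := by
    have h1 : ((X.biUnion badX).card : ℝ) ≤ ∑ x ∈ X, ((badX x).card : ℝ) := by
      exact_mod_cast card_biUnion_le
    have h2 : ∀ x ∈ X, ((badX x).card : ℝ) * (q : ℝ) ^ k = (q : ℝ) ^ (n * k) := fun x hx => by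
      exact_mod_cast hbadX x hx
    calc ((X.biUnion badX).card : ℝ) * (q : ℝ) ^ k ≤ (∑ x ∈ X, ((badX x).card : ℝ)) * (q : ℝ) ^ k := by
          gcongr
      _ = ∑ x ∈ X, ((badX x).card : ℝ) * (q : ℝ) ^ k := sum_mul ..
      _ = ∑ x ∈ X, (q : ℝ) ^ (n * k) := sum_congr rfl h2
      _ = X.card * (q : ℝ) ^ (n * k) := by rw [sum_const, nsmul_eq_mul]
  have hYR : ((Y.biUnion fun y => univ.biUnion (badYs y)).card : ℝ) * (q : ℝ) ^ n ≤
      Y.card * ((q : ℝ) ^ k * (q : ℝ) ^ (k * n)) := by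
    have h1 : ((Y.biUnion fun y => univ.biUnion (badYs y)).card : ℝ) ≤
        ∑ y ∈ Y, ((univ.biUnion (badYs y)).card : ℝ) := by
      exact_mod_cast card_biUnion_le
    have h2 : ∀ y ∈ Y, ((univ.biUnion (badYs y)).card : ℝ) * (q : ℝ) ^ n ≤
        (q : ℝ) ^ k * (q : ℝ) ^ (k * n) := fun y hy => by
      exact_mod_cast hbadY y hy
    calc ((Y.biUnion fun y => univ.biUnion (badYs y)).card : ℝ) * (q : ℝ) ^ n
        ≤ (∑ y ∈ Y, ((univ.biUnion (badYs y)).card : ℝ)) * (q : ℝ) ^ n := by gcongr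
      _ = ∑ y ∈ Y, ((univ.biUnion (badYs y)).card : ℝ) * (q : ℝ) ^ n := sum_mul ..
      _ ≤ ∑ _y ∈ Y, (q : ℝ) ^ k * (q : ℝ) ^ (k * n) := sum_le_sum h2
      _ = Y.card * ((q : ℝ) ^ k * (q : ℝ) ^ (k * n)) := by rw [sum_const, nsmul_eq_mul]
  have hbad : (bad.card : ℝ) < (q : ℝ) ^ (k * n) := by
    have hu : (bad.card : ℝ) ≤ ((X.biUnion badX).card : ℝ) +
        ((Y.biUnion fun y => univ.biUnion (badYs y)).card : ℝ) := by
      exact_mod_cast card_union_le _ _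
    have hqk : (0 : ℝ) < (q : ℝ) ^ k := by positivity
    have hqn : (0 : ℝ) < (q : ℝ) ^ n := by positivity
    have hqkn : (0 : ℝ) < (q : ℝ) ^ (k * n) := by positivity
    -- divide the two bounds through
    have hX' : ((X.biUnion badX).card : ℝ) ≤ X.card / (q : ℝ) ^ k * (q : ℝ) ^ (k * n) := by
      rw [div_mul_eq_mul_div, le_div_iff₀ hqk, mul_comm k n]
      exact hXR
    have hY' : ((Y.biUnion fun y => univ.biUnion (badYs y)).card : ℝ) ≤
        Y.card * (q : ℝ) ^ k / (q : ℝ) ^ n * (q : ℝ) ^ (k * n) := by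
      rw [div_mul_eq_mul_div, le_div_iff₀ hqn]
      calc _ ≤ Y.card * ((q : ℝ) ^ k * (q : ℝ) ^ (k * n)) := hYR
        _ = Y.card * (q : ℝ) ^ k * (q : ℝ) ^ (k * n) := by ring
    calc (bad.card : ℝ) ≤ X.card / (q : ℝ) ^ k * (q : ℝ) ^ (k * n) +
          Y.card * (q : ℝ) ^ k / (q : ℝ) ^ n * (q : ℝ) ^ (k * n) := hu.trans (add_le_add hX' hY')
      _ = (X.card / (q : ℝ) ^ k + Y.card * (q : ℝ) ^ k / (q : ℝ) ^ n) * (q : ℝ) ^ (k * n) := by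
          ring
      _ < 1 * (q : ℝ) ^ (k * n) := by gcongr
      _ = (q : ℝ) ^ (k * n) := one_mul _
  -- so some `F` is good
  have hcardΩ : (univ : Finset (Fin k → Fin n → ZMod q)).card = q ^ (k * n) := by
    rw [card_univ, Fintype.card_pi_const, Fintype.card_pi_const, ZMod.card, ← pow_mul, mul_comm]
  have hlt : bad.card < (univ : Finset (Fin k → Fin n → ZMod q)).card := by
    rw [hcardΩ]; exact_mod_cast hbad
  obtain ⟨F, -, hF⟩ := exists_mem_notMem_of_card_lt_card hlt
  refine ⟨Matrix.of F, fun x hx hxA => hF ?_, fun y hy hyA => hF ?_⟩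
  · -- `x ∈ Λ_q^⊥(A)` means every row of `F` is orthogonal to `x mod q`
    refine mem_union_left _ (mem_biUnion.2 ⟨x, hx, mem_filter.2 ⟨mem_univ _, fun i => ?_⟩⟩)
    have h := congrFun (mem_perpLattice.1 hxA) i
    simpa [mulVec, Matrix.of_apply] using h
  · -- `y ∈ Λ_q(Aᵀ)` means `y ≡ s ᵥ* F` for some `s`
    obtain ⟨s, hs⟩ := mem_rowLattice.1 hyA
    refine mem_union_right _ (mem_biUnion.2 ⟨y, hy, mem_biUnion.2 ⟨s, mem_univ _,
      mem_filter.2 ⟨mem_univ _, fun j => ?_⟩⟩⟩)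
    have h := congrFun hs j
    rw [h, vecMul, dotProduct_comm]
    rfl

end Summit.PneNP.PneNP.Theorems.LatticeMagicMagicFunctionsPersist
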